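import Summits.BirchSwinnertonDyer.Rank1Residual.GaloisImage.TameTorsionWitnesses
import Summits.BirchSwinnertonDyer.Rank1Residual.GaloisImage.ThreeAdicTowerInertiaCriterion
import HarnessLib

/-!
# The `3`-adic tower from surj(3) on a Kodaira-`III` / `III*`-shaped equation (cell `b2b-bsdres`,
# team n1011, seat p14 gen 2 — lead author of OWNERS row T-b9 'tame tower at 3'; step S6 assembly
# over n1011-p02's inertia criterion `GaloisImage/ThreeAdicTowerInertiaCriterion.lean`)

HONEST FRAMING (cell `b2b-bsdres`, run/shared/lean/b2b/bsd-rank1-residual/, verbatim in every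
file): the goal of the cell is to DELETE the COMBINATION-SHAPED residual classes of the
Birch–Swinnerton-Dyer formula for ALL analytic-rank `≤ 1` elliptic curves over `ℚ` — "full BSD
formula for every rank `≤ 1` curve in class `C`" assembled STRICTLY from published theorems — so
that the rank-`≤ 1` remainder becomes exactly the CONSTRUCTION-SHAPED classes, which are TYPED
(missing-input `Prop`s), NOT attempted. This is not "finishing BSD". Team n1011 (N10 / N11, the
additive block X4 ∧ `p = 3`): research route on the CONSTRUCTION-SHAPED class X4; no claim beyond the
stated classes; the label X4 is UNCHANGED by this file; nothing is booked. Theorems only (no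
definition, no named fact; OUR result — Summits side).

## What this file proves

For an integral Weierstrass equation `V`, elliptic over `ℚ`, whose curve `E = V_ℚ` has
`ρ̄_{E,3}` onto `GL₂(𝔽₃)` (this file: the `III` shape; the `III*` twins
`towerSurj_three_of_surj_of_shapeIIIstar_caseA`, `four_dvd_card_inertia_map_three_of_shapeIIIstar_caseB`,
`towerSurj_three_of_surj_of_shapeIIIstar_caseB_of_not_three_dvd` are in the sibling
`GaloisImage/TameThreeAdicTowerIIIstar.lean`, p255883):

* `towerSurj_three_of_surj_of_shapeIII_caseA` — `III`-shape with `3 ∥ b₂` (`3 ∥ b₄`, `9 ∣ b₆`)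
  ⟹ `ρ̄_{E,3ⁿ}` onto for every `n`;
* `four_dvd_card_inertia_map_three_of_shapeIII_caseB` — in CASE B (`9 ∣ b₂`) the inertia group at
  the place over `3` acts on `E[3]` through a group of order divisible by `4` (abscissa valuation
  `1/4`), and `towerSurj_three_of_surj_of_shapeIII_caseB_of_not_three_dvd` — the tower GIVEN
  `3 ∤ #ρ̄₃(I_𝔓)` (the `9`-torsion abscissa valuation `17/36`); the implication
  `4 ∣ #ρ̄₃(I_𝔓) ⟹ 3 ∤ #ρ̄₃(I_𝔓)` (normal Sylow-3 + cyclic tame quotient in `GL₂(𝔽₃)`) is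
  n1011-p02's §5c (`GaloisImage/ThreeTorsionInertiaTame.lean`, p255453); CASE B is CLOSED with it,
  and the Kodaira-level theorems T1/T2 (`towerSurj_three_of_surj_of_kodairaSymbolAt_eq_III` /
  `…_eq_IIIstar`, globally minimal `W/ℚ`, and a model-free twin) are proved, in the sequel
  `GaloisImage/TameThreeAdicTowerKodaira.lean` (p256287); the X4 end-state with the EXOTIC piece on
  the wild Kodaira types only is `Additive/X4ExoticWild.lean` (p256589).

Mechanism (p02's criterion): an inertia element trivial on `E[3]` and non-scalar on `E[9]` exists as
soon as `27 ∣ #ρ̄₉(I)` or (`9 ∣ #ρ̄₉(I)` and `3 ∤ #ρ̄₃(I)`); with surj(3) it excludes Elkies'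
`9`-deficient image, hence (Serre IV-23) gives the whole tower.  The divisibilities come from the
valuations of torsion abscissae (`TameTorsionWitnesses[IIIstar]`: `v(x)²⁷ = v(3)¹³`, `v(x)³⁶ =
v(3)¹⁷`, `v(ξ)⁴ = v(3)`; `III*`: exponents `40, 53, 5`).  What remains for Kodaira `III`/`III*` at
`3` of a GLOBALLY MINIMAL `W/ℚ` is the bridge "Kodaira symbol ⟹ an integer translate of the minimal
model is `III`/`III*`-shaped" (n1011-p04-g3, `GaloisImage/TameThreeKodairaShape.lean`) and the
transport `hasSurjectiveModNGaloisRep_smul_iff`.  Census stake (EVIDENCE, T-b1 engine 1): 7 346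
surj(3) Kodaira III/III* X4@3 r0 cells.  Nothing booked.
-/

noncomputable section

open scoped Classical NumberField

open Polynomial WeierstrassCurve IsDedekindDomain Field

namespace Summit.BirchSwinnertonDyer.Rank1Residual.GaloisImage

open Literature.NumberTheory.EllipticCurves Literature.NumberTheory.GaloisRepresentations
  Rat.HeightOneSpectrum

variable (V : WeierstrassCurve ℤ)

/-! ### CASE A: `27 ∣ #ρ̄₉(I)` -/

/-- **Tame tower, Kodaira-`III` shape, CASE A (`3 ∥ b₂`).** For an integral equation `V` with
`3 ∥ b₂`, `3 ∥ b₄`, `9 ∣ b₆`, elliptic over `ℚ`: `ρ̄_{E,3}` onto ⟹ `ρ̄_{E,3ⁿ}` onto for all `n`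
(`E = V_ℚ`).  A point of order `9` above the non-unit `3`-torsion abscissa has `v(x)²⁷ = v(3)¹³`
(`exists_nineTorsion_valuation_pow_27_eq`), so `27 ∣ #ρ̄₉(I_𝔓)` and p02's criterion applies. -/
theorem towerSurj_three_of_surj_of_shapeIII_caseA [hE : (V.map (Int.castRingHom ℚ)).IsElliptic]
    (hb2 : (3 : ℤ) ∣ V.b₂) (hb2' : ¬ (9 : ℤ) ∣ V.b₂) (hb4 : (3 : ℤ) ∣ V.b₄) (hb4' : ¬ (9 : ℤ) ∣ V.b₄)
    (hb6 : (9 : ℤ) ∣ V.b₆) (hsurj : (V.map (Int.castRingHom ℚ)).HasSurjectiveModNGaloisRep 3)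
    (n : ℕ) : (V.map (Int.castRingHom ℚ)).HasSurjectiveModNGaloisRep (3 ^ n : ℕ) := by
  obtain ⟨Q, x, y, h, hQ, hQ9, hx0, hval⟩ :=
    exists_nineTorsion_valuation_pow_27_eq V hb2 hb2' hb4 hb4' hb6
  have hQt : Q ∈ geomTorsion (V.map (Int.castRingHom ℚ)) 9 := (Submodule.mem_torsionBy_iff _ _).mpr hQ9
  exact forall_hasSurjectiveModNGaloisRep_three_pow_of_surj_of_valuation_X_pow_eq
    (V.map (Int.castRingHom ℚ)) hsurj hQt hQ hx0 hval (by decide) (dvd_refl 27) n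

/-- **CASE B (`9 ∣ b₂`): `4 ∣ #ρ̄_{E,3}(I_𝔓)`** at the prime `𝔓` of the place over `3` — the
abscissa of a point of order `3` has `v(ξ)⁴ = v(3)` (`exists_threeTorsion_valuation_pow_4_eq`). -/
theorem four_dvd_card_inertia_map_three_of_shapeIII_caseB
    [hE : (V.map (Int.castRingHom ℚ)).IsElliptic]
    (hb2 : (9 : ℤ) ∣ V.b₂) (hb4 : (3 : ℤ) ∣ V.b₄) (hb4' : ¬ (9 : ℤ) ∣ V.b₄) (hb6 : (9 : ℤ) ∣ V.b₆)
    {v : HeightOneSpectrum (𝓞 ℚ)} (hv : (primesEquiv v : ℕ) = 3)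
    {𝔓 : Ideal (absIntegers (𝓞 ℚ) ℚ)}
    (hmem : ∀ x : absIntegers (𝓞 ℚ) ℚ, x ∈ 𝔓 ↔ (x : AlgebraicClosure ℚ) ∈ (placeOver 3).nonunits)
    (h𝔓 : 𝔓 ∈ v.primesAbove) :
    4 ∣ Nat.card ((𝔓.inertia (absoluteGaloisGroup ℚ)).map
      (galoisRepTorsion (V.map (Int.castRingHom ℚ)) 3)) := by
  haveI : NeZero (3 : ℕ) := ⟨by norm_num⟩
  obtain ⟨P, ξ, η, h, hP, hP3, hξ0, hval⟩ := exists_threeTorsion_valuation_pow_4_eq V hb2 hb4 hb4' hb6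
  have hPt : P ∈ geomTorsion (V.map (Int.castRingHom ℚ)) (3 : ℕ) :=
    (Submodule.mem_torsionBy_iff _ _).mpr (by exact_mod_cast hP3)
  exact dvd_card_inertia_map_galoisRepTorsion_of_valuation_X_pow_eq (W := V.map (Int.castRingHom ℚ))
    hv hmem h𝔓 hPt hP hξ0 (d := 4) (b := 1) (by rw [pow_one]; exact hval) (by decide)

/-- **Tame tower, Kodaira-`III` shape, CASE B (`9 ∣ b₂`), given `3 ∤ #ρ̄₃(I_𝔓)`** (which p02's §5
derives from `4 ∣ #ρ̄₃(I_𝔓)`, `four_dvd_card_inertia_map_three_of_shapeIII_caseB`): the point of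
order `9` with `v(x)³⁶ = v(3)¹⁷` gives `36 ∣ #ρ̄₉(I_𝔓)`, and the criterion applies. -/
theorem towerSurj_three_of_surj_of_shapeIII_caseB_of_not_three_dvd
    [hE : (V.map (Int.castRingHom ℚ)).IsElliptic]
    (hb2 : (9 : ℤ) ∣ V.b₂) (hb4 : (3 : ℤ) ∣ V.b₄) (hb4' : ¬ (9 : ℤ) ∣ V.b₄) (hb6 : (9 : ℤ) ∣ V.b₆)
    (hsurj : (V.map (Int.castRingHom ℚ)).HasSurjectiveModNGaloisRep 3)
    {v : HeightOneSpectrum (𝓞 ℚ)} (hv : (primesEquiv v : ℕ) = 3)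
    {𝔓 : Ideal (absIntegers (𝓞 ℚ) ℚ)}
    (hmem : ∀ x : absIntegers (𝓞 ℚ) ℚ, x ∈ 𝔓 ↔ (x : AlgebraicClosure ℚ) ∈ (placeOver 3).nonunits)
    (h𝔓 : 𝔓 ∈ v.primesAbove)
    (h3 : ¬ 3 ∣ Nat.card ((𝔓.inertia (absoluteGaloisGroup ℚ)).map
      (galoisRepTorsion (V.map (Int.castRingHom ℚ)) 3)))
    (n : ℕ) : (V.map (Int.castRingHom ℚ)).HasSurjectiveModNGaloisRep (3 ^ n : ℕ) := by
  obtain ⟨Q, x, y, h, hQ, hQ9, hx0, hval⟩ := exists_nineTorsion_valuation_pow_36_eq V hb2 hb4 hb4' hb6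
  have hQt : Q ∈ geomTorsion (V.map (Int.castRingHom ℚ)) 9 := (Submodule.mem_torsionBy_iff _ _).mpr hQ9
  exact forall_hasSurjectiveModNGaloisRep_three_pow_of_surj_of_valuation_X_pow_eq_of_not_three_dvd
    (V.map (Int.castRingHom ℚ)) hsurj hv hmem h𝔓 h3 hQt hQ hx0 hval (by decide) ⟨4, by norm_num⟩ n

end Summit.BirchSwinnertonDyer.Rank1Residual.GaloisImage

end
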